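import Literature.NumberTheory.GaloisRepresentations.IdeleBarKSInflationTrunc
import Literature.NumberTheory.GaloisRepresentations.IdeleProjectionAssembly
import Literature.NumberTheory.GaloisRepresentations.IdeleProjectionHomExt
import HarnessLib

/-!
# The `S`-readout of `Hom_{G_S}(X, I_S)` through `f ↦ f♯`, II: assembly (R3)_S and uniqueness
# (Harari, *Galois Cohomology and CFT*, Prop. 17.26; Milne ADT I Lemma 4.13 for `G_S`)

Topic `NumberTheory/GaloisRepresentations`; namespace `Literature.NumberTheory.GaloisRepresentations.IdeleClassBar`;
sequel to `IdeleBarKSInflationTrunc.lean` (`truncSharp` and its readout invariants) and to door-c6's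
`IdeleProjectionAssembly.lean` (`exists_hom_readoutInvariant_eq`, the all-places idèle assembly) /
`IdeleProjectionHomExt.lean` (`hom_ext_of_ideleProjection_eq`).  THEOREMS ONLY; no named fact, no `sorry`, no instance,
no notation; number fields in `Type`.

THE MATHEMATICS.  `K` a number field, `S` a finite set of finite places, `G_S = Γ_K ⧸ N_S`, `I_S = truncIdeleBar K S`
Harari's truncated idèles (`truncIdeleBarD K S ∈ C_{G_S}`), `π_v = ideleProjection K v` door-c6's idèle projections,
`f♯ = sharp K S f : Inf X ⟶ J̄` the inflation of `f : X ⟶ I_S`.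
* **(R3)_S, assembly** (§3, `exists_hom_readoutInvariant_sharp_eq`): for `X ∈ C_{G_S}` of finite type trivialised by a
  layer and a family `h = (h_v)_v` of invariants `h_v ∈ Hom_ℤ(X|_v, K̄_vˣ)^{Γ_{K_v}}` with `h_v = 0` at the finite
  `v ∉ S`, there is `f : X ⟶ I_S` with `readoutInvariant π_v (Inf X) f♯ = h_v` at EVERY place — door-c6's all-places
  assembly for `Inf X` (its unit condition off `T := S` holds because `h_v = 0` there) followed by `truncSharp`.
  A trivialising layer inside `K_S` always exists (`exists_galLayer_insideKS_forall_ρ_eq`).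
* **Uniqueness** (§4, `hom_ext_of_readoutInvariant_sharp_eq`): `f = g` as soon as the readout invariants of `f♯`,
  `g♯` agree at `v ∈ S` and at the infinite places (off `S` both vanish; door-c6's `hom_ext_of_ideleProjection_eq`
  gives `f♯ = g♯`, then `sharp_injective`).
So `Hom_{G_S}(X, I_S) → ∏_{v ∈ S ∪ ∞} Hom_{Γ_{K_v}}(X, K̄_vˣ)`, `f ↦ (π_v ∘ f♯)_v`, is a bijection for layer-trivialised
`X` of finite type: Milne's Lemma 4.13 / Harari's Prop. 17.26 for `G_S` in door-c6's consumable (readout) form, with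
no condition at the places off `S` (that is the point of `I_S`).

Written for lane «PT-Ш-S-TC» (brick D4b, steps F2b′/F2c′ of `D3-SCOPING-w6g10.md` §6) of crux `GoodLatticeBDPValue`
(cell bsd-eis, item 19032), seat bsd-line-x1-p1-w6 gen 11.  HONEST FRAMING: bookkeeping at the level of
homomorphisms; no arithmetic duality statement and no case of BSD is proved here.

## References
* D. Harari, *Galois Cohomology and Class Field Theory*, Universitext, Springer (2020), Prop. 17.26 (proof), §4.3
  proof of Cor. 4.21 and Remark 4.24, Lemma 15.39. [Harari2020]
* J. S. Milne, *Arithmetic Duality Theorems*, 2nd ed. (2006), I Lemma 4.13 (proof). [MilneADT2006]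
* J. W. S. Cassels, A. Fröhlich (eds.), *Algebraic Number Theory* (1967), Ch. VII (J. Tate) §7.3, §8 Prop. 8.1.
  [CasselsFrohlichANT1967]
-/

noncomputable section

open NumberField NumberField.InfinitePlace IsDedekindDomain CategoryTheory
open Field (absoluteGaloisGroup)
open Literature.NumberTheory.Automorphic Literature.Algebra.Homology Literature.Algebra.Homology.DiscreteRep
open scoped Classical

namespace Literature.NumberTheory.GaloisRepresentations

namespace IdeleClassBar

open IdeleReadout HomDual DGMBridge DiscreteGaloisModule

variable {K : Type} [Field K] [NumberField K] {S : Finset (HeightOneSpectrum (𝓞 K))}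
variable {X : DiscreteRepCat ℤ (GaloisGroupUnramifiedOutside K (↑S : Set (HeightOneSpectrum (𝓞 K))))}

/-! ## §3. (R3)_S: assembly of a `G_S`-morphism `X ⟶ I_S` from local data at `v ∈ S` and at infinity -/

/-- **The readout invariant of any `f♯` vanishes at a finite place `v ∉ S`.** [cite: Harari2020, Lemma 15.39, Prop. 17.26] -/
theorem readoutInvariant_sharp_inr_of_not_mem [Module.Finite ℤ (LCarrier ((inflKS K S).obj X))]
    (f : X ⟶ truncIdeleBarD K S) {v : HeightOneSpectrum (𝓞 K)} (hv : v ∉ S) :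
    readoutInvariant (ideleProjection K (Sum.inr v)) ((inflKS K S).obj X) (sharp K S f) = 0 := by
  rw [← truncSharp_sharp f]
  exact readoutInvariant_sharp_truncSharp_inr_of_not_mem _ hv

/-- **A trivialising layer inside `K_S`**: a `G_S`-object of finite type is fixed pointwise by `U_E` (acting through
`G_S`) for some finite Galois layer `E ⊂ K_S` (`N_S ≤ U_E`). [cite: Harari2020, §4.3 proof of Cor. 4.21, Remark 4.24]
[cite: MilneADT2006, I Lemma 4.13 (proof)] -/
theorem exists_galLayer_insideKS_forall_ρ_eq (X : DiscreteRepCat ℤ (GaloisGroupUnramifiedOutside K (↑S : Set (HeightOneSpectrum (𝓞 K)))))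
    (hX : letI : Module ℤ X.obj.V := X.obj.hV2; Module.Finite ℤ X.obj.V) :
    ∃ (E : GalLayer K), ramificationSubgroup K (↑S : Set (HeightOneSpectrum (𝓞 K))) ≤
        (E.openNormalSubgroup : Subgroup (absoluteGaloisGroup K)) ∧
      ∀ σ ∈ E.openNormalSubgroup, ∀ x : X.obj.V, X.obj.ρ (QuotientGroup.mk σ) x = x := by
  haveI : TotallyDisconnectedSpace (absoluteGaloisGroup K) := inferInstance
  letI : Module ℤ ((inflKS K S).obj X).obj.V := ((inflKS K S).obj X).obj.hV2
  haveI : Module.Finite ℤ ((inflKS K S).obj X).obj.V := hX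
  obtain ⟨U, hU⟩ := exists_openNormalSubgroup_forall_apply_eq (k := ℤ) ((inflKS K S).obj X)
  let W : OpenNormalSubgroup (absoluteGaloisGroup K) :=
    { toSubgroup := (U : Subgroup (absoluteGaloisGroup K)) ⊔ ramificationSubgroup K (↑S : Set (HeightOneSpectrum (𝓞 K)))
      isOpen' := Subgroup.isOpen_mono (le_sup_left (a := (U : Subgroup (absoluteGaloisGroup K)))) U.toOpenSubgroup.isOpen
      isNormal' := Subgroup.sup_normal _ _ }
  have hW : (W : Subgroup (absoluteGaloisGroup K)) =
      (U : Subgroup (absoluteGaloisGroup K)) ⊔ ramificationSubgroup K (↑S : Set (HeightOneSpectrum (𝓞 K))) := rfl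
  refine ⟨GalLayer.ofOpenNormalSubgroup W, ?_, fun σ hσ x => ?_⟩
  · rw [GalLayer.openNormalSubgroup_ofOpenNormalSubgroup, hW]
    exact le_sup_right
  · have hσ' : σ ∈ ((GalLayer.ofOpenNormalSubgroup W).openNormalSubgroup : Subgroup (absoluteGaloisGroup K)) := hσ
    rw [GalLayer.openNormalSubgroup_ofOpenNormalSubgroup, hW] at hσ'
    letI : Module ℤ X.obj.V := X.obj.hV2
    have hle : (U : Subgroup (absoluteGaloisGroup K)) ⊔ ramificationSubgroup K (↑S : Set (HeightOneSpectrum (𝓞 K))) ≤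
        ((inflKS K S).obj X).obj.ρ.ker := by
      refine sup_le (fun τ hτ => LinearMap.ext fun y => hU τ hτ y) fun τ hτ => LinearMap.ext fun y => ?_
      change X.obj.ρ (QuotientGroup.mk τ) y = y
      rw [(QuotientGroup.eq_one_iff τ).mpr hτ, map_one]
      rfl
    have key := LinearMap.congr_fun (MonoidHom.mem_ker.1 (hle hσ')) x
    exact key

/-- **(R3)_S — the idèle assembly for `G_S` and `I_S`** (Harari Prop. 17.26 / Milne I Lemma 4.13 for `G_S`,
existence half): for `X ∈ C_{G_S}` of finite type on which a layer `U_E` acts trivially and a family of invariants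
`h_v ∈ Hom_ℤ(X|_v, K̄_vˣ)^{Γ_{K_v}}` (all places `v`) with `h_v = 0` at the finite `v ∉ S`, there is
`f : X ⟶ I_S` with `π_v ∘ f♯ = h_v` at EVERY place. [cite: Harari2020, Prop. 17.26 (proof)]
[cite: MilneADT2006, I Lemma 4.13 (proof)] [cite: CasselsFrohlichANT1967, Ch. VII §8 Prop. 8.1] -/
theorem exists_hom_readoutInvariant_sharp_eq (X : DiscreteRepCat ℤ (GaloisGroupUnramifiedOutside K (↑S : Set (HeightOneSpectrum (𝓞 K)))))
    [Module.Finite ℤ (LCarrier ((inflKS K S).obj X))] (E : GalLayer K)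
    (hX : ∀ σ ∈ E.openNormalSubgroup, ∀ x : X.obj.V, X.obj.ρ (QuotientGroup.mk σ) x = x)
    (h : ∀ v : Place K,
      (homGaloisModule ((toDGM ((inflKS K S).obj X)).restrictField (Place.Completion v))
        (units (Place.Completion v))).toTopRep.ρ.invariants)
    (hzero : ∀ v : HeightOneSpectrum (𝓞 K), v ∉ S → h (Sum.inr v) = 0) :
    ∃ f : X ⟶ truncIdeleBarD K S, ∀ v : Place K,
      readoutInvariant (ideleProjection K v) ((inflKS K S).obj X) (sharp K S f) = h v := by
  classical
  have hunit : ∀ v : HeightOneSpectrum (𝓞 K), (Sum.inr v : Place K) ∉ S.map ⟨Sum.inr, Sum.inr_injective⟩ →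
      ∀ x : LCarrier ((inflKS K S).obj X), IsNonarchimedeanLocalField.ordQ (v.adicCompletion K)
        ((show LCarrier ((inflKS K S).obj X) →ₗ[ℤ] UnitsCarrier (v.adicCompletion K) from
          ((h (Sum.inr v)).1 : DiscreteRep.HomCarrier (LCarrier ((inflKS K S).obj X))
            (UnitsCarrier (v.adicCompletion K)))) x) = 0 := by
    intro v hv x
    have hv' : v ∉ S := fun hvS => hv (Finset.mem_map.2 ⟨v, hvS, rfl⟩)
    rw [hzero v hv']
    exact map_zero _
  obtain ⟨f₀, hf₀⟩ := exists_hom_readoutInvariant_eq ((inflKS K S).obj X) E (fun σ hσ x => hX σ hσ x)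
    (S.map ⟨Sum.inr, Sum.inr_injective⟩) h hunit
  refine ⟨truncSharp f₀, fun v => ?_⟩
  rcases v with w | v
  · rw [readoutInvariant_sharp_truncSharp_inl, hf₀]
  · by_cases hv : v ∈ S
    · rw [readoutInvariant_sharp_truncSharp_inr_of_mem f₀ hv, hf₀]
    · rw [readoutInvariant_sharp_truncSharp_inr_of_not_mem f₀ hv, hzero v hv]

/-! ## §4. Uniqueness: `f` is determined by the readouts of `f♯` at `v ∈ S` and at the infinite places -/

/-- **A `G_S`-morphism `f : X ⟶ I_S` out of a layer-trivialised `X` is determined by the values `π_v (f♯ x)` at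
the places `v ∈ S` and at the infinite places** (off `S` they vanish for every `f`).
[cite: Harari2020, Prop. 17.26 (proof)] [cite: MilneADT2006, I Lemma 4.13 (proof)] [cite: CasselsFrohlichANT1967, Ch. VII §7.3, §8 Prop. 8.1] -/
theorem hom_ext_of_ideleProjection_sharp_eq (E : GalLayer K)
    (hX : ∀ σ ∈ E.openNormalSubgroup, ∀ x : X.obj.V, X.obj.ρ (QuotientGroup.mk σ) x = x)
    {f g : X ⟶ truncIdeleBarD K S}
    (hfin : ∀ v ∈ S, ∀ x : X.obj.V,
      finIdelePi v ((sharp K S f).hom.hom x) = finIdelePi v ((sharp K S g).hom.hom x))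
    (hinf : ∀ (v : InfinitePlace K) (x : X.obj.V),
      archIdelePi v ((sharp K S f).hom.hom x) = archIdelePi v ((sharp K S g).hom.hom x)) :
    f = g := by
  apply sharp_injective
  refine hom_ext_of_ideleProjection_eq (X := (inflKS K S).obj X) E (fun σ hσ x => hX σ hσ x) fun v x => ?_
  rcases v with w | v
  · rw [ideleProjection_inl_toAddMonoidHom]
    exact hinf w x
  · rw [ideleProjection_inr_toAddMonoidHom]
    by_cases hv : v ∈ S
    · exact hfin v hv x
    · change finIdelePi v ((sharp K S f).hom.hom x) = finIdelePi v ((sharp K S g).hom.hom x)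
      rw [finIdelePi_sharp_of_not_mem f hv, finIdelePi_sharp_of_not_mem g hv]

variable [Module.Finite ℤ (LCarrier ((inflKS K S).obj X))]

/-- **A `G_S`-morphism `f : X ⟶ I_S` out of a layer-trivialised finite-type `X` is determined by the readout
invariants of `f♯` at `v ∈ S` and at the infinite places** — the uniqueness companion of
`exists_hom_readoutInvariant_sharp_eq`. [cite: Harari2020, Prop. 17.26 (proof)] [cite: MilneADT2006, I Lemma 4.13 (proof)] -/
theorem hom_ext_of_readoutInvariant_sharp_eq (E : GalLayer K)
    (hX : ∀ σ ∈ E.openNormalSubgroup, ∀ x : X.obj.V, X.obj.ρ (QuotientGroup.mk σ) x = x)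
    {f g : X ⟶ truncIdeleBarD K S}
    (hfin : ∀ v ∈ S, readoutInvariant (ideleProjection K (Sum.inr v)) ((inflKS K S).obj X) (sharp K S f) =
      readoutInvariant (ideleProjection K (Sum.inr v)) ((inflKS K S).obj X) (sharp K S g))
    (hinf : ∀ v : InfinitePlace K, readoutInvariant (ideleProjection K (Sum.inl v)) ((inflKS K S).obj X) (sharp K S f) =
      readoutInvariant (ideleProjection K (Sum.inl v)) ((inflKS K S).obj X) (sharp K S g)) :
    f = g := by
  refine hom_ext_of_ideleProjection_sharp_eq E hX (fun v hv x => ?_) (fun v x => ?_)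
  · have h := LinearMap.congr_fun (congrArg (fun F => ((F.1 :
      DiscreteRep.HomCarrier (LCarrier ((inflKS K S).obj X)) (UnitsCarrier (Place.Completion (Sum.inr v : Place K)))) :
        LCarrier ((inflKS K S).obj X) →ₗ[ℤ] UnitsCarrier (Place.Completion (Sum.inr v : Place K)))) (hfin v hv))
      (LCarrier.of ((inflKS K S).obj X) x)
    rw [coe_readoutInvariant, coe_readoutInvariant, readoutMap_apply, readoutMap_apply, LCarrier.val_of,
      ideleProjection_inr_toAddMonoidHom] at h
    exact h
  · have h := LinearMap.congr_fun (congrArg (fun F => ((F.1 :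
      DiscreteRep.HomCarrier (LCarrier ((inflKS K S).obj X)) (UnitsCarrier (Place.Completion (Sum.inl v : Place K)))) :
        LCarrier ((inflKS K S).obj X) →ₗ[ℤ] UnitsCarrier (Place.Completion (Sum.inl v : Place K)))) (hinf v))
      (LCarrier.of ((inflKS K S).obj X) x)
    rw [coe_readoutInvariant, coe_readoutInvariant, readoutMap_apply, readoutMap_apply, LCarrier.val_of,
      ideleProjection_inl_toAddMonoidHom] at h
    exact h

/-- **All-places form**: `f = g` as soon as the readout invariants of `f♯` and `g♯` agree at every place.
[cite: MilneADT2006, I Lemma 4.13 (proof)] -/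
theorem hom_ext_of_forall_readoutInvariant_sharp_eq (E : GalLayer K)
    (hX : ∀ σ ∈ E.openNormalSubgroup, ∀ x : X.obj.V, X.obj.ρ (QuotientGroup.mk σ) x = x)
    {f g : X ⟶ truncIdeleBarD K S}
    (h : ∀ v : Place K, readoutInvariant (ideleProjection K v) ((inflKS K S).obj X) (sharp K S f) =
      readoutInvariant (ideleProjection K v) ((inflKS K S).obj X) (sharp K S g)) :
    f = g :=
  hom_ext_of_readoutInvariant_sharp_eq E hX (fun v _ => h (Sum.inr v)) (fun v => h (Sum.inl v))

/-- **`f ↦ (π_v ∘ f♯)_{v ∈ S ∪ ∞}` is injective** on `Hom_{G_S}(X, I_S)` for a layer-trivialised finite-type `X`.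
[cite: Harari2020, Prop. 17.26] [cite: MilneADT2006, I Lemma 4.13] -/
theorem readoutInvariant_sharp_injective (E : GalLayer K)
    (hX : ∀ σ ∈ E.openNormalSubgroup, ∀ x : X.obj.V, X.obj.ρ (QuotientGroup.mk σ) x = x) :
    Function.Injective fun f : X ⟶ truncIdeleBarD K S =>
      (fun v : S => readoutInvariant (ideleProjection K (Sum.inr (v : HeightOneSpectrum (𝓞 K)))) ((inflKS K S).obj X) (sharp K S f),
        fun v : InfinitePlace K => readoutInvariant (ideleProjection K (Sum.inl v)) ((inflKS K S).obj X) (sharp K S f)) :=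
  fun _ _ hfg => hom_ext_of_readoutInvariant_sharp_eq E hX
    (fun v hv => congrFun (congrArg Prod.fst hfg) ⟨v, hv⟩) (fun v => congrFun (congrArg Prod.snd hfg) v)

end IdeleClassBar

end Literature.NumberTheory.GaloisRepresentations

end
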